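import Summits.QuantumFields.YangMills.Theorems.BalabanUVNodesN15PerCubeGreenTwoGridEntryThreeReg335HolderLetters
import Summits.QuantumFields.YangMills.Theorems.BalabanUVNodesN15PerCubeGreenTwoGridKnitDefectReg335Small
import HarnessLib

/-!
# N15 = NE2, road (c) — PROGRAMME (PC), ENTRY 3 OF (3.42) AT TWO SPACINGS WITHOUT JETS, SMALL-DATA EDITION: `(1 + κ_e√|m|·√|m|)²(C∕ξ + C∕ξ²) ≤ c₀` ⟹ cube gauges with
# `𝔇_{τ_S}(Δ_{R_U′}∘G′(U′), Δ_{R_U}∘G′(U)) ≤ D·((L^k)^{−1∕4} + o_B)·e^{−ρ₀|y−y′|_T}` from ONE datum `Reg335HolderCube` per cube — n15-c∕373's twin on n15-c∕384, with the η-rate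
# bookkeeping of the located summand row: THIS FILE = the pure real-algebra lemma `entryThree_letters_bookkeeping` (n15-c∕363's lemma with the entry-3 conclusion); the editions are n15-c∕385b (dag-n15-c g34, n15-c∕385a)

Cell `pub-ymgap`, seat `pub-ymgap-dag-n15-c` (generation g34; R134 (a) seat, strategy s1 «first missing estimate»; HUMAN RULING D-0062; chair R424 venue).
`bears_on: R4∕N15 · K3⁸ SpineGivenEndpointR13SepCoPHV (stmt-QuantumFields-27366)`; filed `--kind proof --supports stmt-QuantumFields-27366 --as helper` — COUNT-NEUTRAL.
ONE theorem here (pure real algebra, no carriers): `entryThree_letters_bookkeeping`; its consumers (n15-c∕385b `…EntryThreeReg335HolderSmall`): ★★★ `uN_idef_scGreen_entryThree_of_reg335Holder_small` (`∃ δ w₀ c₀ D ρ₀`, majorant `D·((L^k)^{−1∕4} + o_B)·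
e^{−ρ₀d}` — the SAME shape as n15-c∕373's, so n15-c∕374's rate bookkeeping transfers verbatim); `…_small_explicit` (o_B := o_B^{H,expl} of n15-c∕369∕371).  Imports BY NAME n15-c∕384
`…EntryThreeReg335HolderLetters`, n15-c∕363 `…KnitDefectReg335Small` (`abs_aK_sub_aK_le`, `inv_le_rpow_neg_quarter`, `one_add_pow_sub_one_le` via [B7]).  373's source transformed by HOME
`tools/g34/build_H18.py`; nothing in the tree is modified, no landed name re-declared.  CONSTANT: `D₃ = a₀|ι|²·max(D,0)·(1 + A_η + B_c + K_B)·c + |K|·K_OP·B·c`, `K_OP` explicit in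
`a₀, |ι|, d, c₀, π` (the partition fit's `π(d+1)`), `|K| = (2L)^{d+1}`; `κ_e`, `|m|` enter only through the smallness hypothesis, as in 373.
HONEST FRAMING ∕ LIMITS as in n15-c∕383∕384: MODEL carriers (King tori, one cube scale, straight-holonomy pairing), the SHAPE of [B9] Thm 3.14 ∕ (3.42) entry 3 for the scalar `G′(U)`, NOT
the printed theorem; NE2⁺ NOT PRINTED ∕ NOT proved; N15 of record untouched (DISCHARGED AS CONSUMED, p687738); K3⁸ OPEN; counts UNMOVED (typed 28∕28 · discharged 8∕27); one finite 𝕋⁴ at fixed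
ε per index — NOT infinite volume, NOT OS on ℝ⁴, NOT a mass gap, NOT Clay.  Restate-immune (no Theses import).
-/



set_option autoImplicit false

noncomputable section

open scoped BigOperators Matrix Matrix.Norms.L2Operator
open Finset

namespace Summit.QuantumFields.YangMills.BalabanUVNodes.N15.Gluing

open Real
open Literature.MathematicalPhysics.QuantumFieldTheory.Balaban1983to89
open Literature.MathematicalPhysics.QuantumFieldTheory.Balaban1983to89.B5Prop11Plancherel (Tor fine unitVec)
open Literature.MathematicalPhysics.QuantumFieldTheory.Balaban1983to89.B11SectG (BlockNorm HasMaj)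
open Literature.MathematicalPhysics.QuantumFieldTheory.Balaban1983to89.T4EtaRateDefect (idef)
open Literature.MathematicalPhysics.QuantumFieldTheory.Balaban1983to89.B6UnitTorusCarrier (unitTorusGeo)
open Summit.QuantumFields.YangMills.BalabanUVNodes.N15.CurvedSpecies (Reg335HolderCube)
open Literature.MathematicalPhysics.QuantumFieldTheory.King1986 (aK aK_pos aK_le)
open Literature.MathematicalPhysics.QuantumFieldTheory.King1986.Torus (tdistT)
open Literature.MathematicalPhysics.QuantumFieldTheory.Balaban1983to89.B7Prop10InLambdaRec (one_add_pow_sub_one_le)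
open Literature.Barriers.QuantumFields (traceForm)
open Summit.QuantumFields.YangMills.BalabanUVNodes.N15.BackgroundLayer (tCoefA tCoefC covLapM)
open Summit.QuantumFields.YangMills.BalabanUVNodes.N15.VectorPiece (kingPr)
open Summit.QuantumFields.YangMills.BalabanUVNodes.N15.MatrixSpecies (coordMat basisConst basisConst_nonneg liftBlk liftMap)
open Summit.QuantumFields.YangMills.BalabanUVNodes.N15.CurvedSpecies (gaugePair)
open Summit.QuantumFields.YangMills.BalabanUVNodes.N15.CovAvg (mprod kingSec ctauS)

variable {d : ℕ}

/-! ## §1 The η-rate bookkeeping of the located summand row -/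

set_option maxHeartbeats 3200000 in
/-- ★ **THE η-RATE BOOKKEEPING FOR ENTRY 3, pure real algebra** — n15-c∕363's `letters_bookkeeping` (its hypotheses VERBATIM, its threshold conclusion unchanged) with the second
conclusion replaced by the entry-3 majorant: `a₀|ι|²·D·X·c + |K|·o_P·B·c ≤ D₃·((L^k)^{−1∕4} + o_B)`, where `o_P` is n15-c∕379's constant read in the same letters (`EP` in place of `Ep`:
the located summand row uses the column letter `η′p`, `p = Ep∕η`) plus the partition fit `o_h ≤ K_O·x` and `(4∕3)a₀L^{−2k} ≤ (4∕3)a₀·x`. [folklore; cite: Balaban1985BackgroundPropagators,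
(3.51)–(3.52) p.400 (shape of the small-field bookkeeping)] -/
theorem entryThree_letters_bookkeeping
    (I dd dd1 J JJ nr Lk Lr Lrm η' η κ sm t t₂ pf qf Ep P Qq P1 Q1 EP PC E3 X INNER TA TC KTH aKk aKrk ON RV E1 E2 E4 x14 L2inv oB a₀ R₀ K₁ K₂ c₀ KI Aη Bc KB D ex : ℝ)
    (Nr M1 M2 M4 : ℕ)
    (hI0 : 0 ≤ I) (hdd0 : 0 ≤ dd) (hdd1 : dd1 = dd + 1) (hJ : J = dd + 1) (hJJ : JJ = 2 * (dd + 1)) (ha₀ : 0 < a₀)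
    (hK₁ : K₁ = I * (6 + (dd + 1) * (36 * I + 6))) (hK₂ : K₂ = (1 + 2 * (dd + 1)) + 2 * a₀ * I * (4 * (dd + 1) ^ 2 * I + 4 * (dd + 1)))
    (hc₀pos : 0 < c₀) (hc₀a : c₀ ≤ 1 / (100 * (dd + 1) * (I + 1) * (K₁ + 1))) (hc₀b : c₀ ≤ R₀ / (K₁ * K₂ + 1))
    (hKI : KI = (3 * (dd + 2) + 72 * I) * c₀)
    (hAη : Aη = (I * KI + I ^ 2 * (dd + 1) * KI) * (1 + 2 * (dd + 1)) + 2 * a₀ * I ^ 2 * ((dd + 1) * (3 * dd + 6) * c₀) + 12 * (dd + 1) * I * c₀)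
    (hBc : Bc = 2 * a₀ * I * (1 + I)) (hKB : KB = I * (dd + 1) * (1 + 2 * (dd + 1)))
    (hLk1 : 1 ≤ Lk) (hLr1 : 1 ≤ Lr) (hnrdef : nr = Lr * Lk) (hLrmdef : Lrm = Lr - 1) (hηqdef : η' = nr⁻¹) (hηdef : η = Lk⁻¹)
    (hNr : (Nr : ℝ) = Lr) (hM1 : (M1 : ℝ) = (dd + 1) * Lk) (hM2 : (M2 : ℝ) = (dd + 1) * nr) (hM4 : (M4 : ℝ) = (dd + 1) * Lrm)
    (hκ : 0 ≤ κ) (hsm : 0 ≤ sm) (ht0 : 0 ≤ t) (ht₂0 : 0 ≤ t₂) (hsmall : (1 + κ * sm) ^ 2 * (t + t₂) ≤ c₀)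
    (hpfdef : pf = t * Real.exp (η' * t)) (hqfdef : qf = t₂ * Real.exp (η' * t))
    (hEpdef : Ep = (1 + η' * pf) ^ Nr - 1) (hPdef : P = Ep / η) (hQqdef : Qq = qf * (1 + η' * pf) ^ Nr)
    (hP1def : P1 = κ * (sm * P)) (hQ1def : Q1 = κ * (sm * Qq)) (hEPdef : EP = (1 + η' * P) ^ Nr - 1) (hPCdef : PC = Lk * (κ * (sm * EP)))
    (hE3def : E3 = (1 + I * (η' * P1)) ^ Nr - 1) (hXdef : X = dd1 * Lrm + Lr + 1)
    (hINNERdef : INNER = nr * (κ * (sm * (X * (η' ^ 2 * qf))) + E3 * (η' * P1))) (hTAdef : TA = I * INNER) (hTCdef : TC = I * (J * (oB + I * (INNER * (P1 + PC)))))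
    (hKTHdef : KTH = κ * (sm * ((dd + 1) * (dd * (nr * (Lr * (η' ^ 2 * qf))) + Ep))))
    (haK : |aKk| ≤ a₀) (hΔaK : |aKrk - aKk| ≤ 2 * a₀ * L2inv)
    (hONdef : ON = I * (|aKrk - aKk| * (1 + I) + |aKk| * (2 * I * KTH)))
    (hRVdef : RV = I * P1 + I * (J * (I * P1 ^ 2 + Q1))) (hE1def : E1 = (1 + RV * η) ^ M1 - 1) (hE2def : E2 = (1 + RV * η') ^ M2 - 1)
    (hE4def : E4 = (1 + (I * (η' * P1))) ^ M4 - 1) (hx0 : 0 ≤ x14) (hηx : η ≤ x14) (hL2x : L2inv ≤ x14) (hoB : 0 ≤ oB) (hex : 0 < ex)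
    (bA Bg cc NK KO OHo MQ E5 ON3 KOP : ℝ) (hbAdef : bA = a₀ * I ^ 2) (hBg0 : 0 ≤ Bg) (hcc0 : 0 ≤ cc) (hNK0 : 0 ≤ NK) (hKO0 : 0 ≤ KO) (hOHox : OHo ≤ KO * x14)
    (hMQx : MQ ≤ 4 / 3 * a₀ * x14) (hE5def : E5 = (1 + I * (κ * (sm * (η' * P)))) ^ M4 - 1)
    (hON3def : ON3 = I * (|aKrk - aKk| * (1 + I) + |aKk| * (2 * I * (κ * (sm * ((dd + 1) * (dd * (nr * (Lr * (η' ^ 2 * qf))) + EP)))))))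
    (hKOPdef : KOP = bA * I * KO + I ^ 2 * (4 / 3 * a₀ + Bc + 2 * a₀ * I ^ 2 * ((dd + 1) * (3 * dd + 12) * c₀) + bA * I * KO + 2 * bA * (12 * (dd + 1) * I * c₀))) :
    RV * (1 + JJ) + (a₀ * (I * (I * E1 ^ 2 + 2 * E1)) + a₀ * (I * (I * E2 ^ 2 + 2 * E2))) ≤ R₀ ∧
      (bA * (D * (x14 + ((TA + TC) * (1 + JJ) + ON + E4))) * cc + (NK * (bA * (I * OHo) + I ^ 2 * (MQ + ON3 + bA * (I * OHo) + E5 * bA + E5 * bA))) * Bg * cc) * ex ≤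
        (bA * max D 0 * (1 + Aη + Bc + KB) * cc + NK * KOP * Bg * cc) * (x14 + oB) * ex := by
  obtain ⟨hK₁0, hK₂0, hKI0⟩ : 0 ≤ K₁ ∧ 0 ≤ K₂ ∧ 0 ≤ KI := ⟨by rw [hK₁]; positivity, by rw [hK₂]; positivity, by rw [hKI]; positivity⟩
  obtain ⟨hAη0, hBc0, hKB0⟩ : 0 ≤ Aη ∧ 0 ≤ Bc ∧ 0 ≤ KB := ⟨by rw [hAη]; positivity, by rw [hBc]; positivity, by rw [hKB]; positivity⟩
  have hdd1p : (0 : ℝ) ≤ dd + 1 := by linarith only [hdd0]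
  have hI1p : (0 : ℝ) ≤ I + 1 := by linarith only [hI0]
  have hIc : 100 * ((dd + 1) * ((I + 1) * ((K₁ + 1) * c₀))) ≤ 1 := by
    have h := hc₀a; rw [le_div_iff₀ (by positivity)] at h; linarith only [h]
  have hc₀1 : c₀ ≤ 1 / 100 := by
    have h2 : (1 : ℝ) * c₀ ≤ ((dd + 1) * ((I + 1) * (K₁ + 1))) * c₀ :=
      mul_le_mul_of_nonneg_right (by nlinarith only [hdd0, hI0, hK₁0, mul_nonneg hdd0 hI0, mul_nonneg (mul_nonneg hdd0 hI0) hK₁0, mul_nonneg hdd0 hK₁0, mul_nonneg hI0 hK₁0]) hc₀pos.le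
    linarith only [h2, hIc]
  set S : ℝ := κ * sm with hSdef
  have hS0 : 0 ≤ S := by positivity
  have hsq : (1 : ℝ) ≤ (1 + S) ^ 2 := by nlinarith only [hS0, sq_nonneg S]
  have hsum : t + t₂ ≤ c₀ := by linarith only [hsmall, mul_le_mul_of_nonneg_right hsq (add_nonneg ht0 ht₂0)]
  obtain ⟨htc, ht₂c⟩ : t ≤ c₀ ∧ t₂ ≤ c₀ := ⟨by linarith only [hsum, ht₂0], by linarith only [hsum, ht0]⟩
  obtain ⟨hSsq, hS2sq⟩ : S ≤ (1 + S) ^ 2 ∧ S ^ 2 ≤ (1 + S) ^ 2 := ⟨by nlinarith only [hS0, sq_nonneg S], by nlinarith only [hS0]⟩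
  have hStc : S * t ≤ c₀ := by linarith only [hsmall, mul_le_mul_of_nonneg_right hSsq (add_nonneg ht0 ht₂0), mul_nonneg hS0 ht₂0]
  have hSt₂c : S * t₂ ≤ c₀ := by linarith only [hsmall, mul_le_mul_of_nonneg_right hSsq (add_nonneg ht0 ht₂0), mul_nonneg hS0 ht0]
  have hS2tc : S ^ 2 * t ≤ c₀ := by linarith only [hsmall, mul_le_mul_of_nonneg_right hS2sq (add_nonneg ht0 ht₂0), mul_nonneg (sq_nonneg S) ht₂0]
  have ht1 : t ≤ 1 := htc.trans (hc₀1.trans (by norm_num))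
  obtain ⟨hLk0, hLr0⟩ : 0 < Lk ∧ 0 < Lr := ⟨by linarith only [hLk1], by linarith only [hLr1]⟩
  have hnr0 : 0 < nr := by rw [hnrdef]; positivity
  obtain ⟨hη, hη'⟩ : 0 < η ∧ 0 < η' := ⟨by rw [hηdef]; exact inv_pos.mpr hLk0, by rw [hηqdef]; exact inv_pos.mpr hnr0⟩
  have hη1 : η ≤ 1 := by rw [hηdef]; exact inv_le_one_of_one_le₀ hLk1
  obtain ⟨hLkη, hnrη'⟩ : Lk * η = 1 ∧ nr * η' = 1 := ⟨by rw [hηdef]; exact mul_inv_cancel₀ hLk0.ne', by rw [hηqdef]; exact mul_inv_cancel₀ hnr0.ne'⟩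
  have hLrη' : Lr * η' = η := by
    rw [hηqdef, hηdef, hnrdef, mul_inv, ← mul_assoc, mul_inv_cancel₀ hLr0.ne', one_mul]
  have hη'1 : η' ≤ 1 := (by rw [← hLrη']; exact le_mul_of_one_le_left hη'.le hLr1 : η' ≤ η).trans hη1
  -- the printed letters
  have hexp3 : Real.exp (η' * t) ≤ 3 :=
    (Real.exp_le_exp.mpr (mul_le_one₀ hη'1 ht0 ht1)).trans (by linarith only [Real.exp_one_lt_d9])
  obtain ⟨hpf0, hqf0⟩ : 0 ≤ pf ∧ 0 ≤ qf := ⟨by rw [hpfdef]; positivity, by rw [hqfdef]; positivity⟩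
  obtain ⟨hpf, hqf⟩ : pf ≤ 3 * t ∧ qf ≤ 3 * t₂ := ⟨by rw [hpfdef]; nlinarith only [hexp3, ht0], by rw [hqfdef]; nlinarith only [hexp3, ht₂0]⟩
  have hEp0 : 0 ≤ Ep := by
    have := one_le_pow₀ (M₀ := ℝ) (a := 1 + η' * pf) (le_add_of_nonneg_right (mul_nonneg hη'.le hpf0)) (n := Nr); rw [hEpdef]; linarith only [this]
  have hηpf : η * pf ≤ 1 := by linarith only [mul_le_of_le_one_left hpf0 hη1, hpf, htc, hc₀1]
  have hEp : Ep ≤ 2 * (η * pf) := by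
    have h := one_add_pow_sub_one_le (mul_nonneg hη'.le hpf0) (n := Nr) (by rw [hNr, ← mul_assoc, hLrη']; exact hηpf)
    rw [hNr, show Lr * (η' * pf) = (Lr * η') * pf by ring, hLrη'] at h; rw [hEpdef]; exact h
  obtain ⟨hP0, hP⟩ : 0 ≤ P ∧ P ≤ 2 * pf := ⟨by rw [hPdef]; exact div_nonneg hEp0 hη.le, by rw [hPdef, div_le_iff₀ hη]; linarith only [hEp]⟩
  have hP6 : P ≤ 6 * t := by linarith only [hP, hpf]
  have hQq0 : 0 ≤ Qq := by rw [hQqdef]; positivity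
  have hQq : Qq ≤ 6 * t₂ := by
    have h1 : (1 + η' * pf) ^ Nr = Ep + 1 := by rw [hEpdef]; ring
    rw [hQqdef, h1]
    have h2 : Ep ≤ 1 := by linarith only [hEp, mul_le_of_le_one_left hpf0 hη1, hpf, htc, hc₀1]
    nlinarith only [h2, hqf, hqf0, hEp0]
  have hP1S : P1 = S * P := by rw [hP1def, hSdef]; ring
  have hP10 : 0 ≤ P1 := hP1S ▸ mul_nonneg hS0 hP0
  have hP1 : P1 ≤ 6 * (S * t) := by rw [hP1S]; nlinarith only [mul_le_mul_of_nonneg_left hP6 hS0]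
  have hP1c : P1 ≤ 6 * c₀ := by linarith only [hP1, hStc]
  have hQ1S : Q1 = S * Qq := by rw [hQ1def, hSdef]; ring
  obtain ⟨hQ10, hQ1c⟩ : 0 ≤ Q1 ∧ Q1 ≤ 6 * c₀ := ⟨hQ1S ▸ mul_nonneg hS0 hQq0, by rw [hQ1S]; linarith only [mul_le_mul_of_nonneg_left hQq hS0, hSt₂c]⟩
  have hEP0 : 0 ≤ EP := by
    have := one_le_pow₀ (M₀ := ℝ) (a := 1 + η' * P) (le_add_of_nonneg_right (mul_nonneg hη'.le hP0)) (n := Nr); rw [hEPdef]; linarith only [this]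
  have hEP : EP ≤ 2 * (η * P) := by
    have h := one_add_pow_sub_one_le (mul_nonneg hη'.le hP0) (n := Nr) (by
      rw [hNr, ← mul_assoc, hLrη']; linarith only [mul_le_of_le_one_left hP0 hη1, hP6, htc, hc₀1])
    rw [hNr, show Lr * (η' * P) = (Lr * η') * P by ring, hLrη'] at h; rw [hEPdef]; exact h
  have hPC0 : 0 ≤ PC := by rw [hPCdef]; positivity
  have hPCc : PC ≤ 12 * c₀ := by
    have e1 : PC = S * (Lk * EP) := by rw [hPCdef, hSdef]; ring
    have h2 : Lk * EP ≤ 2 * P := by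
      calc Lk * EP ≤ Lk * (2 * (η * P)) := mul_le_mul_of_nonneg_left hEP hLk0.le
        _ = 2 * (Lk * η) * P := by ring
        _ = 2 * P := by rw [hLkη]; ring
    rw [e1]; linarith only [mul_le_mul_of_nonneg_left h2 hS0, mul_le_mul_of_nonneg_left hP6 hS0, hStc]
  have hE30 : 0 ≤ E3 := by
    have := one_le_pow₀ (M₀ := ℝ) (a := 1 + I * (η' * P1)) (le_add_of_nonneg_right (by positivity)) (n := Nr); rw [hE3def]; linarith only [this]
  have hIP1 : I * P1 ≤ I * (6 * c₀) := mul_le_mul_of_nonneg_left hP1c hI0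
  have hIc' : 6 * ((dd + 1) * ((I + 1) * c₀)) ≤ 1 := by
    nlinarith only [hIc, hK₁0, mul_nonneg (mul_nonneg (mul_nonneg hdd1p hI1p) hc₀pos.le) hK₁0, mul_nonneg (mul_nonneg hdd1p hI1p) hc₀pos.le]
  have hIηP1 : (dd + 1) * (I * (η * P1)) ≤ 1 := by
    have h1 : I * (η * P1) ≤ I * (6 * c₀) := (mul_le_mul_of_nonneg_left (mul_le_of_le_one_left hP10 hη1) hI0).trans hIP1
    have h2 := mul_le_mul_of_nonneg_left h1 hdd1p
    nlinarith only [h2, hIc', hc₀pos.le, hdd1p]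
  have hE3 : E3 ≤ 2 * (I * (η * P1)) := by
    have h := one_add_pow_sub_one_le (a := I * (η' * P1)) (by positivity) (n := Nr) (by
      rw [hNr, show Lr * (I * (η' * P1)) = I * (Lr * η') * P1 by ring, hLrη']
      nlinarith only [hIηP1, hdd0, mul_nonneg hI0 (mul_nonneg hη.le hP10)])
    rw [hNr, show Lr * (I * (η' * P1)) = I * (Lr * η') * P1 by ring, hLrη'] at h
    rw [hE3def]; linarith only [h]
  -- (i) the threshold
  have hRV0 : 0 ≤ RV := by rw [hRVdef, hJ]; positivity
  have hP1sq : P1 ^ 2 ≤ 36 * c₀ := by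
    have h1a : P1 * P1 ≤ (6 * (S * t)) * (6 * (S * t)) := mul_le_mul hP1 hP1 hP10 (by positivity)
    have h1b : S ^ 2 * t * t ≤ S ^ 2 * t * 1 := mul_le_mul_of_nonneg_left ht1 (by positivity)
    nlinarith only [h1a, h1b, hS2tc]
  have hRV : RV ≤ K₁ * c₀ := by
    rw [hRVdef, hJ, hK₁]
    nlinarith only [hIP1, mul_le_mul_of_nonneg_left hP1sq (mul_nonneg (mul_nonneg hI0 hdd1p) hI0), mul_le_mul_of_nonneg_left hQ1c (mul_nonneg hI0 hdd1p)]
  have hRVd : (dd + 1) * RV ≤ 1 / 100 := by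
    have h1 : (dd + 1) * RV ≤ (dd + 1) * (K₁ * c₀) := mul_le_mul_of_nonneg_left hRV hdd1p
    have hK : K₁ * c₀ ≤ (I + 1) * ((K₁ + 1) * c₀) := by nlinarith only [hI0, hK₁0, hc₀pos.le, mul_nonneg hI0 (mul_nonneg hK₁0 hc₀pos.le), mul_nonneg hI0 hc₀pos.le]
    have h2 := mul_le_mul_of_nonneg_left hK hdd1p
    linarith only [h1, h2, hIc]
  have hRV1 : RV ≤ 1 := by nlinarith only [hRVd, hRV0, hdd0, mul_nonneg hdd0 hRV0]
  have hE10 : 0 ≤ E1 := by have := one_le_pow₀ (M₀ := ℝ) (a := 1 + RV * η) (le_add_of_nonneg_right (by positivity)) (n := M1); rw [hE1def]; linarith only [this]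
  have hE20 : 0 ≤ E2 := by have := one_le_pow₀ (M₀ := ℝ) (a := 1 + RV * η') (le_add_of_nonneg_right (by positivity)) (n := M2); rw [hE2def]; linarith only [this]
  have hE1 : E1 ≤ 2 * ((dd + 1) * RV) := by
    have hN : (M1 : ℝ) * (RV * η) = (dd + 1) * RV * (Lk * η) := by rw [hM1]; ring
    have h := one_add_pow_sub_one_le (a := RV * η) (by positivity) (n := M1) (by rw [hN, hLkη, mul_one]; linarith only [hRVd])
    rw [hN, hLkη, mul_one] at h; rw [hE1def]; exact h
  have hE2 : E2 ≤ 2 * ((dd + 1) * RV) := by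
    have hN : (M2 : ℝ) * (RV * η') = (dd + 1) * RV * (nr * η') := by rw [hM2]; ring
    have h := one_add_pow_sub_one_le (a := RV * η') (by positivity) (n := M2) (by rw [hN, hnrη', mul_one]; linarith only [hRVd])
    rw [hN, hnrη', mul_one] at h; rw [hE2def]; exact h
  have hRle : RV * (1 + JJ) + (a₀ * (I * (I * E1 ^ 2 + 2 * E1)) + a₀ * (I * (I * E2 ^ 2 + 2 * E2))) ≤ R₀ := by
    have hRV2 : RV * RV ≤ RV * 1 := mul_le_mul_of_nonneg_left hRV1 hRV0
    have h1 : E1 ^ 2 ≤ 4 * (dd + 1) ^ 2 * RV := by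
      nlinarith only [mul_le_mul hE1 hE1 hE10 (by positivity), mul_le_mul_of_nonneg_left hRV2 (by positivity : (0:ℝ) ≤ 4 * (dd + 1) ^ 2)]
    have h2 : E2 ^ 2 ≤ 4 * (dd + 1) ^ 2 * RV := by
      nlinarith only [mul_le_mul hE2 hE2 hE20 (by positivity), mul_le_mul_of_nonneg_left hRV2 (by positivity : (0:ℝ) ≤ 4 * (dd + 1) ^ 2)]
    have h3 : RV * (1 + JJ) + (a₀ * (I * (I * E1 ^ 2 + 2 * E1)) + a₀ * (I * (I * E2 ^ 2 + 2 * E2))) ≤ RV * K₂ := by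
      rw [hJJ, hK₂]
      nlinarith only [mul_le_mul_of_nonneg_left h1 (mul_nonneg ha₀.le (mul_nonneg hI0 hI0)), mul_le_mul_of_nonneg_left h2 (mul_nonneg ha₀.le (mul_nonneg hI0 hI0)),
        mul_le_mul_of_nonneg_left hE1 (mul_nonneg ha₀.le hI0), mul_le_mul_of_nonneg_left hE2 (mul_nonneg ha₀.le hI0)]
    have h4 : RV * K₂ ≤ K₁ * c₀ * K₂ := mul_le_mul_of_nonneg_right hRV hK₂0
    have h5 : K₁ * K₂ * c₀ ≤ R₀ := by
      have h := hc₀b; rw [le_div_iff₀ (by positivity)] at h; nlinarith only [h, hc₀pos.le]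
    nlinarith only [h3, h4, h5]
  refine ⟨hRle, ?_⟩
  -- (ii) the rate
  have hX : X ≤ (dd + 2) * Lr := by rw [hXdef, hdd1, hLrmdef]; nlinarith only [hdd0]
  have hX0 : 0 ≤ X := by rw [hXdef, hdd1, hLrmdef]; nlinarith only [mul_nonneg hdd0 (sub_nonneg.mpr hLr1), hLr1]
  have hINNER : INNER ≤ η * KI := by
    rw [hINNERdef, hKI]
    have h1 : nr * (κ * (sm * (X * (η' ^ 2 * qf))) + E3 * (η' * P1)) = S * ((nr * η') * ((X * η') * qf)) + (nr * η') * (E3 * P1) := by rw [hSdef]; ring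
    have h2 : X * η' ≤ (dd + 2) * η := by
      calc X * η' ≤ (dd + 2) * Lr * η' := mul_le_mul_of_nonneg_right hX hη'.le
        _ = (dd + 2) * η := by rw [mul_assoc, hLrη']
    rw [h1, hnrη', one_mul, one_mul]
    have h3 : S * ((X * η') * qf) ≤ 3 * (dd + 2) * c₀ * η := by
      calc S * ((X * η') * qf) ≤ S * ((dd + 2) * η * (3 * t₂)) := mul_le_mul_of_nonneg_left (mul_le_mul h2 hqf hqf0 (by positivity)) hS0
        _ = 3 * (dd + 2) * (S * t₂) * η := by ring
        _ ≤ 3 * (dd + 2) * c₀ * η := by nlinarith only [mul_le_mul_of_nonneg_left hSt₂c (show (0:ℝ) ≤ 3 * (dd + 2) * η by positivity)]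
    have h4 : E3 * P1 ≤ 72 * I * c₀ * η := by
      calc E3 * P1 ≤ (2 * (I * (η * P1))) * P1 := mul_le_mul_of_nonneg_right hE3 hP10
        _ = 2 * I * η * P1 ^ 2 := by ring
        _ ≤ 2 * I * η * (36 * c₀) := mul_le_mul_of_nonneg_left hP1sq (by positivity)
        _ = 72 * I * c₀ * η := by ring
    nlinarith only [h3, h4]
  have hINNER0 : 0 ≤ INNER := by rw [hINNERdef]; positivity
  have hTA : TA ≤ η * (I * KI) := by rw [hTAdef]; nlinarith only [mul_le_mul_of_nonneg_left hINNER hI0]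
  have hTC : TC ≤ I * (dd + 1) * oB + η * (I ^ 2 * (dd + 1) * KI) := by
    rw [hTCdef, hJ]
    have h1 : P1 + PC ≤ 1 := by linarith only [hP1c, hPCc, hc₀1]
    have h2 : INNER * (P1 + PC) ≤ η * KI := (mul_le_of_le_one_right hINNER0 h1).trans hINNER
    nlinarith only [mul_le_mul_of_nonneg_left h2 (mul_nonneg hI0 (mul_nonneg hdd1p hI0))]
  have hKTH : KTH ≤ η * ((dd + 1) * (3 * dd + 6) * c₀) := by
    rw [hKTHdef]
    have h1 : nr * (Lr * (η' ^ 2 * qf)) = (nr * η') * (Lr * η') * qf := by ring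
    rw [h1, hnrη', hLrη', one_mul]
    have h2 : κ * (sm * ((dd + 1) * (dd * (η * qf) + Ep))) = (dd + 1) * (dd * (η * (S * qf)) + S * Ep) := by rw [hSdef]; ring
    rw [h2]
    have h3 : S * qf ≤ 3 * c₀ := by linarith only [mul_le_mul_of_nonneg_left hqf hS0, hSt₂c]
    have h4 : S * Ep ≤ 6 * c₀ * η := by
      calc S * Ep ≤ S * (2 * (η * pf)) := mul_le_mul_of_nonneg_left hEp hS0
        _ = 2 * η * (S * pf) := by ring
        _ ≤ 2 * η * (3 * c₀) := mul_le_mul_of_nonneg_left (by linarith only [mul_le_mul_of_nonneg_left hpf hS0, hStc]) (by positivity)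
        _ = 6 * c₀ * η := by ring
    nlinarith only [mul_le_mul_of_nonneg_left (add_le_add (mul_le_mul_of_nonneg_left (mul_le_mul_of_nonneg_left h3 hη.le) hdd0) h4) hdd1p]
  have hKTH0 : 0 ≤ KTH := by rw [hKTHdef]; positivity
  have hON : ON ≤ L2inv * Bc + η * (2 * a₀ * I ^ 2 * ((dd + 1) * (3 * dd + 6) * c₀)) := by
    rw [hONdef, hBc]
    have h1 : |aKrk - aKk| * (1 + I) ≤ 2 * a₀ * L2inv * (1 + I) := mul_le_mul_of_nonneg_right hΔaK (by linarith only [hI0])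
    have h2 : |aKk| * (2 * I * KTH) ≤ a₀ * (2 * I * (η * ((dd + 1) * (3 * dd + 6) * c₀))) :=
      mul_le_mul haK (mul_le_mul_of_nonneg_left hKTH (by positivity)) (by positivity) ha₀.le
    nlinarith only [mul_le_mul_of_nonneg_left (add_le_add h1 h2) hI0]
  have hE40 : 0 ≤ E4 := by
    have := one_le_pow₀ (M₀ := ℝ) (a := 1 + I * (η' * P1)) (le_add_of_nonneg_right (by positivity)) (n := M4); rw [hE4def]; linarith only [this]
  have hE4 : E4 ≤ η * (12 * (dd + 1) * I * c₀) := by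
    have hN : (M4 : ℝ) ≤ (dd + 1) * Lr := by rw [hM4, hLrmdef]; nlinarith only [hdd0]
    have hNa : (M4 : ℝ) * (I * (η' * P1)) ≤ (dd + 1) * (I * (η * P1)) := by
      calc (M4 : ℝ) * (I * (η' * P1)) ≤ (dd + 1) * Lr * (I * (η' * P1)) := mul_le_mul_of_nonneg_right hN (by positivity)
        _ = (dd + 1) * (I * ((Lr * η') * P1)) := by ring
        _ = (dd + 1) * (I * (η * P1)) := by rw [hLrη']
    have h := one_add_pow_sub_one_le (a := I * (η' * P1)) (by positivity) (n := M4) (hNa.trans hIηP1)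
    rw [hE4def]
    calc _ ≤ 2 * ((M4 : ℝ) * (I * (η' * P1))) := h
      _ ≤ 2 * ((dd + 1) * (I * (η * P1))) := by linarith only [hNa]
      _ = 2 * (dd + 1) * η * (I * P1) := by ring
      _ ≤ 2 * (dd + 1) * η * (I * (6 * c₀)) := mul_le_mul_of_nonneg_left hIP1 (by positivity)
      _ = η * (12 * (dd + 1) * I * c₀) := by ring
  obtain ⟨hTA0, hTC0, hON0⟩ : 0 ≤ TA ∧ 0 ≤ TC ∧ 0 ≤ ON := ⟨by rw [hTAdef]; positivity, by rw [hTCdef, hJ]; positivity, by rw [hONdef]; positivity⟩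
  have hA' : (0 : ℝ) ≤ (I * KI + I ^ 2 * (dd + 1) * KI) * (1 + 2 * (dd + 1)) + 2 * a₀ * I ^ 2 * ((dd + 1) * (3 * dd + 6) * c₀) + 12 * (dd + 1) * I * c₀ := by positivity
  have hsumR : (TA + TC) * (1 + JJ) + ON + E4 ≤ (Aη + Bc + KB) * (x14 + oB) := by
    rw [hJJ, hAη, hKB]
    nlinarith only [mul_le_mul_of_nonneg_right (add_le_add hTA hTC) (show (0:ℝ) ≤ 1 + 2 * (dd + 1) by positivity), hON, hE4,
      mul_le_mul_of_nonneg_right hηx hA', mul_le_mul_of_nonneg_right hL2x hBc0, mul_nonneg hA' hoB, mul_nonneg hBc0 hoB,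
      mul_nonneg (show (0:ℝ) ≤ I * (dd + 1) * (1 + 2 * (dd + 1)) by positivity) hx0, hoB, hx0, hI0, hdd0]
  have hrate0 : 0 ≤ x14 + ((TA + TC) * (1 + JJ) + ON + E4) := by rw [hJJ]; positivity
  have hXsum : x14 + ((TA + TC) * (1 + JJ) + ON + E4) ≤ (1 + Aη + Bc + KB) * (x14 + oB) := by
    nlinarith only [hsumR, hoB, hx0, hAη0, hBc0, hKB0]
  -- the located row of the summand: the same letters, `EP` in place of `Ep`, plus `o_h`, `L^{−2k}`
  have hE5E4 : E5 = E4 := by rw [hE5def, hE4def, hP1S, hSdef]; ring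
  have hKTH3 : κ * (sm * ((dd + 1) * (dd * (nr * (Lr * (η' ^ 2 * qf))) + EP))) ≤ η * ((dd + 1) * (3 * dd + 12) * c₀) := by
    have h1 : nr * (Lr * (η' ^ 2 * qf)) = (nr * η') * (Lr * η') * qf := by ring
    rw [h1, hnrη', hLrη', one_mul]
    have h2 : κ * (sm * ((dd + 1) * (dd * (η * qf) + EP))) = (dd + 1) * (dd * (η * (S * qf)) + S * EP) := by rw [hSdef]; ring
    rw [h2]
    have h3 : S * qf ≤ 3 * c₀ := by linarith only [mul_le_mul_of_nonneg_left hqf hS0, hSt₂c]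
    have h4 : S * EP ≤ 12 * c₀ * η := by
      calc S * EP ≤ S * (2 * (η * P)) := mul_le_mul_of_nonneg_left hEP hS0
        _ = 2 * η * (S * P) := by ring
        _ ≤ 2 * η * (6 * c₀) := mul_le_mul_of_nonneg_left (by linarith only [mul_le_mul_of_nonneg_left hP6 hS0, hStc]) (by positivity)
        _ = 12 * c₀ * η := by ring
    nlinarith only [mul_le_mul_of_nonneg_left (add_le_add (mul_le_mul_of_nonneg_left (mul_le_mul_of_nonneg_left h3 hη.le) hdd0) h4) hdd1p]
  have hON3 : ON3 ≤ L2inv * Bc + η * (2 * a₀ * I ^ 2 * ((dd + 1) * (3 * dd + 12) * c₀)) := by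
    rw [hON3def, hBc]
    have h1 : |aKrk - aKk| * (1 + I) ≤ 2 * a₀ * L2inv * (1 + I) := mul_le_mul_of_nonneg_right hΔaK (by linarith only [hI0])
    have h2 : |aKk| * (2 * I * (κ * (sm * ((dd + 1) * (dd * (nr * (Lr * (η' ^ 2 * qf))) + EP))))) ≤ a₀ * (2 * I * (η * ((dd + 1) * (3 * dd + 12) * c₀))) :=
      mul_le_mul haK (mul_le_mul_of_nonneg_left hKTH3 (by positivity)) (by positivity) ha₀.le
    nlinarith only [mul_le_mul_of_nonneg_left (add_le_add h1 h2) hI0]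
  have hE5 : E5 ≤ η * (12 * (dd + 1) * I * c₀) := by rw [hE5E4]; exact hE4
  have hE50 : 0 ≤ E5 := by rw [hE5E4]; exact hE40
  have hbA0 : 0 ≤ bA := by rw [hbAdef]; positivity
  have hKOP0 : 0 ≤ KOP := by rw [hKOPdef]; positivity
  have hOPx : bA * (I * OHo) + I ^ 2 * (MQ + ON3 + bA * (I * OHo) + E5 * bA + E5 * bA) ≤ KOP * x14 := by
    have t1 : bA * (I * OHo) ≤ bA * (I * (KO * x14)) := mul_le_mul_of_nonneg_left (mul_le_mul_of_nonneg_left hOHox hI0) hbA0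
    have hL2 : L2inv * Bc ≤ x14 * Bc := mul_le_mul_of_nonneg_right hL2x hBc0
    have hηA : η * (2 * a₀ * I ^ 2 * ((dd + 1) * (3 * dd + 12) * c₀)) ≤ x14 * (2 * a₀ * I ^ 2 * ((dd + 1) * (3 * dd + 12) * c₀)) := mul_le_mul_of_nonneg_right hηx (by positivity)
    have hηB : η * (12 * (dd + 1) * I * c₀) ≤ x14 * (12 * (dd + 1) * I * c₀) := mul_le_mul_of_nonneg_right hηx (by positivity)
    have hON3x : ON3 ≤ x14 * Bc + x14 * (2 * a₀ * I ^ 2 * ((dd + 1) * (3 * dd + 12) * c₀)) := hON3.trans (add_le_add hL2 hηA)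
    have hE5x : E5 * bA ≤ (x14 * (12 * (dd + 1) * I * c₀)) * bA := mul_le_mul_of_nonneg_right (hE5.trans hηB) hbA0
    have t2 : I ^ 2 * (MQ + ON3 + bA * (I * OHo) + E5 * bA + E5 * bA) ≤
        I ^ 2 * (4 / 3 * a₀ * x14 + (x14 * Bc + x14 * (2 * a₀ * I ^ 2 * ((dd + 1) * (3 * dd + 12) * c₀))) + bA * (I * (KO * x14)) + (x14 * (12 * (dd + 1) * I * c₀)) * bA + (x14 * (12 * (dd + 1) * I * c₀)) * bA) :=
      mul_le_mul_of_nonneg_left (add_le_add (add_le_add (add_le_add (add_le_add hMQx hON3x) t1) hE5x) hE5x) (sq_nonneg I)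
    calc _ ≤ _ := add_le_add t1 t2
      _ = KOP * x14 := by rw [hKOPdef]; ring
  calc (bA * (D * (x14 + ((TA + TC) * (1 + JJ) + ON + E4))) * cc + (NK * (bA * (I * OHo) + I ^ 2 * (MQ + ON3 + bA * (I * OHo) + E5 * bA + E5 * bA))) * Bg * cc) * ex
      ≤ (bA * (max D 0 * ((1 + Aη + Bc + KB) * (x14 + oB))) * cc + (NK * (KOP * (x14 + oB))) * Bg * cc) * ex := by
        refine mul_le_mul_of_nonneg_right (add_le_add ?_ ?_) hex.le
        · refine mul_le_mul_of_nonneg_right (mul_le_mul_of_nonneg_left ?_ hbA0) hcc0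
          calc D * (x14 + ((TA + TC) * (1 + JJ) + ON + E4)) ≤ max D 0 * (x14 + ((TA + TC) * (1 + JJ) + ON + E4)) := mul_le_mul_of_nonneg_right (le_max_left _ _) hrate0
            _ ≤ max D 0 * ((1 + Aη + Bc + KB) * (x14 + oB)) := mul_le_mul_of_nonneg_left hXsum (le_max_right _ _)
        · refine mul_le_mul_of_nonneg_right (mul_le_mul_of_nonneg_right (mul_le_mul_of_nonneg_left ?_ hNK0) hBg0) hcc0
          exact hOPx.trans (mul_le_mul_of_nonneg_left (le_add_of_nonneg_right hoB) hKOP0)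
    _ = (bA * max D 0 * (1 + Aη + Bc + KB) * cc + NK * KOP * Bg * cc) * (x14 + oB) * ex := by ring



end Summit.QuantumFields.YangMills.BalabanUVNodes.N15.Gluing

end
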